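import Mathlib
import HarnessLib
import Summits.ValiantsHypothesis.ValiantsHypothesis.Theorems.LacunarySymmetroidMatrixDescartesProductPlusOneSlopeKnee

/-!
# LINE (A) `product_plus_one`, floor in W-currency: SWITCHED COHERENT rows are PULLS — the hump-versus-pull cells hold against MIXED clouds
# (unswitched incoherent rows AND switched coherent rows)

From the slope identity of ✓ `…SlopeConvexity` (`rowPsi_slope_identity`), a coherent `(+,+,−)` row BEYOND its zero (normal form `A > 0`, `B < 0 < C`,
`A − Bx^p − Cx^q < 0`, `u < 0`; its Euler ratio decays from `+∞` to `q`) has a POSITIVE slope form (`ψ₁ > 0`: the slope `θφ = −ψ₁` is negative) which is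
strictly LOG-CONVEX (`ψ₂² < ψ₁ψ₃`: both identity terms are negative).  So, for the W-count, a switched coherent row behaves exactly like an unswitched incoherent
puller, and every «one hump against a cloud» cell (riser ✓ p689322, knee / rising coherent ✓ p691373) extends to MIXED clouds:
* `switchedCoherent_rowPsi1_pos`, ★ `switchedCoherent_slope_logConvex`, `switchedCoherent_rowPsi3_pos`;
* `mixedCloud_hasDerivAt1/2`, `mixedCloud_signs`, ★ `mixedCloud_lcP1` — a weighted finite family of rows, each either an unswitched incoherent row
  (`B_i, C_i ≥ 0`, `B_i + C_i > 0`, value `> 0`) or a switched coherent row (`A_i > 0`, `B_i < 0 < C_i`, value `< 0`): `cloudP1 > 0`, `cloudP2² ≤ cloudP1·cloudP3`;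
* ★ `slope_no_three_zeros_of_pull` — the abstract engine of ✓ `…SlopeKnee` with an ABSTRACT pull (`P1 > 0`, `θP1 = P2`, `θP2 = P3`, `P2² ≤ P1P3` on the window);
* ★★ `hump_mixedCloud_no_three_zeros` — any row with rising strictly log-concave slope on the window against a mixed cloud ⇒ `ψ₁ + cloudP1` has no three zeros;
  ★★ `oneRiser_mixedCloud_no_three_zeros` — the switched incoherent riser (`a ≥ 0`, `b, c > 0`) instance, turning persistence included.
So the ρ_I = 1 cell holds on windows where coherent rows of the company have ALREADY switched (the far side of the «T4 + T5 at ratio > 4» core), complementing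
✓ `…SlopeCoherent` (coherent row not yet switched, rising).  HONEST FRAMING: cells; coherent rows in their PULLING-but-unswitched phase (between turning point
and zero) are NOT covered (slope negative but not log-convex in general); several humps, `OneChangeFloorK3`, `WronskianBudgetK3`, the stubs, `MatrixDescartes`
OPEN; `VP ≠ VNP` NOT proved.  No definitions, no named facts.
-/

set_option linter.dupNamespace false

namespace Summit.ValiantsHypothesis.ValiantsHypothesis.Theorems.LacunarySymmetroidMatrixDescartes

namespace ProductPlusOne

open Finset
open scoped BigOperators

/-! ### §1 A switched coherent row is a pull -/

section Row

variable (e₁ e₂ : ℕ) (A B C : ℝ)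

/-- `ψ₁ = u²·(H₁² + H₂·F)` and `H₁² + H₂F = −βγ(q−p)² + A·H₂` (`F = A − β − γ = 1/u`). [folklore] -/
theorem rowPsi1_eq_sq_mul {x : ℝ} (hF : A - B * x ^ (e₁ + 1) - C * x ^ (e₁ + e₂ + 2) ≠ 0) :
    rowPsi1 e₁ e₂ A B C x = rowU e₁ e₂ A B C x ^ 2 *
      (-(B * x ^ (e₁ + 1)) * (C * x ^ (e₁ + e₂ + 2)) * ((e₂ : ℝ) + 1) ^ 2 + A * rowH e₁ e₂ 2 B C x) := by
  unfold rowPsi1 rowH rowU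
  field_simp
  ring

/-- **A switched coherent row has positive slope form** (`A > 0`, `B < 0 < C`, value `< 0`): `ψ₁ > 0` (its Euler ratio decreases). [this file's lemma] -/
theorem switchedCoherent_rowPsi1_pos {x : ℝ} (hx : 0 < x) (hA : 0 < A) (hB : B < 0) (hC : 0 < C)
    (hF : A - B * x ^ (e₁ + 1) - C * x ^ (e₁ + e₂ + 2) < 0) : 0 < rowPsi1 e₁ e₂ A B C x := by
  have hu2 : 0 < rowU e₁ e₂ A B C x ^ 2 := by
    have : rowU e₁ e₂ A B C x ≠ 0 := by unfold rowU; exact inv_ne_zero hF.ne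
    positivity
  have hβγ : 0 < -(B * x ^ (e₁ + 1)) * (C * x ^ (e₁ + e₂ + 2)) * ((e₂ : ℝ) + 1) ^ 2 := by
    have : 0 < -(B * x ^ (e₁ + 1)) := by have := mul_neg_of_neg_of_pos hB (pow_pos hx (e₁ + 1)); linarith
    positivity
  rcases le_or_gt 0 (rowH e₁ e₂ 2 B C x) with hH2 | hH2
  · rw [rowPsi1_eq_sq_mul e₁ e₂ A B C hF.ne]
    exact mul_pos hu2 (by nlinarith [mul_nonneg hA.le hH2])
  · -- `H₂ < 0`: `ψ₁ = H₂u + H₁²u² ≥ H₂u > 0`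
    have hu : rowU e₁ e₂ A B C x < 0 := by unfold rowU; exact inv_lt_zero.2 hF
    unfold rowPsi1
    have h1 : 0 < rowH e₁ e₂ 2 B C x * rowU e₁ e₂ A B C x := mul_pos_of_neg_of_neg hH2 hu
    have h2 : 0 ≤ rowH e₁ e₂ 1 B C x ^ 2 * rowU e₁ e₂ A B C x ^ 2 := by positivity
    linarith

/-- ★ **A switched coherent row's slope form is strictly log-convex:** `ψ₂² < ψ₁ψ₃` (`A > 0`, `B < 0 < C`, value `< 0`). [this file's theorem] -/
theorem switchedCoherent_slope_logConvex {x : ℝ} (hx : 0 < x) (hA : 0 < A) (hB : B < 0) (hC : 0 < C)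
    (hF : A - B * x ^ (e₁ + 1) - C * x ^ (e₁ + e₂ + 2) < 0) :
    rowPsi2 e₁ e₂ A B C x ^ 2 < rowPsi1 e₁ e₂ A B C x * rowPsi3 e₁ e₂ A B C x := by
  have hid := rowPsi_slope_identity e₁ e₂ A B C x
  have hψ1 := rowPsi1_eq_mul e₁ e₂ A B C x
  have hpos := switchedCoherent_rowPsi1_pos e₁ e₂ A B C hx hA hB hC hF
  set u := rowU e₁ e₂ A B C x with hudef
  set E := rowH e₁ e₂ 2 B C x + rowH e₁ e₂ 1 B C x ^ 2 * u with hE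
  have hu : u < 0 := by rw [hudef]; unfold rowU; exact inv_lt_zero.2 hF
  have hEneg : E < 0 := by
    rw [hψ1] at hpos
    by_contra h; push Not at h
    have : u * E ≤ 0 := mul_nonpos_of_nonpos_of_nonneg hu.le h
    linarith
  have hcube : -2 * u * E ^ 3 < 0 := by
    have hE3 : E ^ 3 < 0 := by
      have : E ^ 3 = E * E ^ 2 := by ring
      rw [this]; exact mul_neg_of_neg_of_pos hEneg (sq_pos_iff.mpr hEneg.ne)
    nlinarith
  have hAu : rowH e₁ e₂ 0 B C x * u + 1 = A * u := by rw [hudef]; exact rowH0_mul_rowU_add_one e₁ e₂ A B C hF.ne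
  have hterm2 : -(((e₁ : ℝ) + 1) ^ 2 * ((e₁ : ℝ) + e₂ + 2) ^ 2 * ((e₂ : ℝ) + 1) ^ 2 * (B * x ^ (e₁ + 1))
      * (C * x ^ (e₁ + e₂ + 2)) * (rowH e₁ e₂ 0 B C x * u + 1)) ≤ 0 := by
    rw [hAu]
    have hc : 0 ≤ ((e₁ : ℝ) + 1) ^ 2 * ((e₁ : ℝ) + e₂ + 2) ^ 2 * ((e₂ : ℝ) + 1) ^ 2 := by positivity
    have hβ : B * x ^ (e₁ + 1) ≤ 0 := (mul_neg_of_neg_of_pos hB (pow_pos hx _)).le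
    have hγ : 0 ≤ C * x ^ (e₁ + e₂ + 2) := by positivity
    have hAu' : A * u ≤ 0 := (mul_neg_of_pos_of_neg hA hu).le
    have : 0 ≤ ((e₁ : ℝ) + 1) ^ 2 * ((e₁ : ℝ) + e₂ + 2) ^ 2 * ((e₂ : ℝ) + 1) ^ 2 * (B * x ^ (e₁ + 1))
        * (C * x ^ (e₁ + e₂ + 2)) * (A * u) := by
      have h1 : 0 ≤ (B * x ^ (e₁ + 1)) * (A * u) := mul_nonneg_of_nonpos_of_nonpos hβ hAu'
      have : ((e₁ : ℝ) + 1) ^ 2 * ((e₁ : ℝ) + e₂ + 2) ^ 2 * ((e₂ : ℝ) + 1) ^ 2 * (B * x ^ (e₁ + 1)) * (C * x ^ (e₁ + e₂ + 2)) * (A * u)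
          = (((e₁ : ℝ) + 1) ^ 2 * ((e₁ : ℝ) + e₂ + 2) ^ 2 * ((e₂ : ℝ) + 1) ^ 2 * (C * x ^ (e₁ + e₂ + 2))) * ((B * x ^ (e₁ + 1)) * (A * u)) := by
        ring
      rw [this]; positivity
    linarith
  have hu2 : 0 < u ^ 2 := sq_pos_iff.mpr hu.ne
  have : rowPsi2 e₁ e₂ A B C x ^ 2 - rowPsi1 e₁ e₂ A B C x * rowPsi3 e₁ e₂ A B C x < 0 := by
    rw [hid]; exact mul_neg_of_pos_of_neg hu2 (by linarith)
  linarith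

/-- `ψ₃ > 0` for a switched coherent row (from `ψ₁ > 0` and `ψ₂² < ψ₁ψ₃`). [this file's lemma] -/
theorem switchedCoherent_rowPsi3_pos {x : ℝ} (hx : 0 < x) (hA : 0 < A) (hB : B < 0) (hC : 0 < C)
    (hF : A - B * x ^ (e₁ + 1) - C * x ^ (e₁ + e₂ + 2) < 0) : 0 < rowPsi3 e₁ e₂ A B C x := by
  have h1 := switchedCoherent_rowPsi1_pos e₁ e₂ A B C hx hA hB hC hF
  have h2 := switchedCoherent_slope_logConvex e₁ e₂ A B C hx hA hB hC hF
  have : 0 < rowPsi1 e₁ e₂ A B C x * rowPsi3 e₁ e₂ A B C x := lt_of_le_of_lt (sq_nonneg _) h2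
  exact pos_of_mul_pos_right this h1.le |> fun h => by nlinarith

end Row

/-! ### §2 Mixed clouds -/

section Cloud

variable (e₁ e₂ : ℕ) {ι : Type*} (s : Finset ι) (m A B C : ι → ℝ)

/-- `d/dx P1 = P2/x` for any family of non-vanishing rows. [folklore] -/
theorem mixedCloud_hasDerivAt1 {x : ℝ} (hx : 0 < x) (hF : ∀ i ∈ s, A i - B i * x ^ (e₁ + 1) - C i * x ^ (e₁ + e₂ + 2) ≠ 0) :
    HasDerivAt (cloudP1 e₁ e₂ s m A B C) (cloudP2 e₁ e₂ s m A B C x / x) x := by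
  have h := HasDerivAt.fun_sum (u := s) fun i hi =>
    (hasDerivAt_rowPsi1 e₁ e₂ (A i) (B i) (C i) hx.ne' (hF i hi)).const_mul (m i)
  refine (h.congr_of_eventuallyEq (Filter.Eventually.of_forall fun t => ?_)).congr_deriv ?_
  · simp only [cloudP1]
  · simp only [cloudP2, Finset.sum_div]
    exact Finset.sum_congr rfl fun i _ => by ring

/-- `d/dx P2 = P3/x` for any family of non-vanishing rows. [folklore] -/
theorem mixedCloud_hasDerivAt2 {x : ℝ} (hx : 0 < x) (hF : ∀ i ∈ s, A i - B i * x ^ (e₁ + 1) - C i * x ^ (e₁ + e₂ + 2) ≠ 0) :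
    HasDerivAt (cloudP2 e₁ e₂ s m A B C) (cloudP3 e₁ e₂ s m A B C x / x) x := by
  have h := HasDerivAt.fun_sum (u := s) fun i hi =>
    (hasDerivAt_rowPsi2 e₁ e₂ (A i) (B i) (C i) hx.ne' (hF i hi)).const_mul (m i)
  refine (h.congr_of_eventuallyEq (Filter.Eventually.of_forall fun t => ?_)).congr_deriv ?_
  · simp only [cloudP2]
  · simp only [cloudP3, Finset.sum_div]
    exact Finset.sum_congr rfl fun i _ => by ring

variable {s m A B C}

/-- **Mixed cloud, signs and log-convexity of the slope.**  Every row of `s` is either an unswitched incoherent row (`B_i, C_i ≥ 0`, `B_i + C_i > 0`, value `> 0`)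
or a switched coherent row (`A_i > 0`, `B_i < 0 < C_i`, value `< 0`), weights `m_i > 0`, `s` nonempty: `P1 > 0`, `P3 ≥ 0` termwise and `P2² ≤ P1·P3`.
[this file's theorem] -/
theorem mixedCloud_lcP1 {x : ℝ} (hx : 0 < x) (hs : s.Nonempty) (hm : ∀ i ∈ s, 0 < m i)
    (hrow : ∀ i ∈ s, (0 ≤ B i ∧ 0 ≤ C i ∧ 0 < B i + C i ∧ 0 < A i - B i * x ^ (e₁ + 1) - C i * x ^ (e₁ + e₂ + 2))
      ∨ (0 < A i ∧ B i < 0 ∧ 0 < C i ∧ A i - B i * x ^ (e₁ + 1) - C i * x ^ (e₁ + e₂ + 2) < 0)) :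
    0 < cloudP1 e₁ e₂ s m A B C x ∧ cloudP2 e₁ e₂ s m A B C x ^ 2 ≤ cloudP1 e₁ e₂ s m A B C x * cloudP3 e₁ e₂ s m A B C x := by
  have hψ : ∀ i ∈ s, 0 < rowPsi1 e₁ e₂ (A i) (B i) (C i) x ∧ 0 ≤ rowPsi3 e₁ e₂ (A i) (B i) (C i) x ∧
      rowPsi2 e₁ e₂ (A i) (B i) (C i) x ^ 2 ≤ rowPsi1 e₁ e₂ (A i) (B i) (C i) x * rowPsi3 e₁ e₂ (A i) (B i) (C i) x := by
    intro i hi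
    rcases hrow i hi with ⟨hB, hC, hBC, hF⟩ | ⟨hA, hB, hC, hF⟩
    · exact ⟨(rowPsi_signs e₁ e₂ (A i) (B i) (C i) hx hB hC hBC hF).2.1, rowPsi3_nonneg e₁ e₂ hx hB hC hF,
        puller_slope_logConvex e₁ e₂ (A i) (B i) (C i) hx hB hC hF⟩
    · exact ⟨switchedCoherent_rowPsi1_pos e₁ e₂ (A i) (B i) (C i) hx hA hB hC hF,
        (switchedCoherent_rowPsi3_pos e₁ e₂ (A i) (B i) (C i) hx hA hB hC hF).le,
        (switchedCoherent_slope_logConvex e₁ e₂ (A i) (B i) (C i) hx hA hB hC hF).le⟩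
  refine ⟨?_, ?_⟩
  · unfold cloudP1
    exact Finset.sum_pos (fun i hi => mul_pos (hm i hi) (hψ i hi).1) hs
  · unfold cloudP1 cloudP2 cloudP3
    refine lc_sum s _ _ _ (fun i hi => mul_nonneg (hm i hi).le (hψ i hi).1.le)
      (fun i hi => mul_nonneg (hm i hi).le (hψ i hi).2.1) ?_
    intro i hi
    have h := (hψ i hi).2.2
    have hm2 : 0 ≤ m i ^ 2 := sq_nonneg _
    calc (m i * rowPsi2 e₁ e₂ (A i) (B i) (C i) x) ^ 2 = m i ^ 2 * rowPsi2 e₁ e₂ (A i) (B i) (C i) x ^ 2 := by ring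
      _ ≤ m i ^ 2 * (rowPsi1 e₁ e₂ (A i) (B i) (C i) x * rowPsi3 e₁ e₂ (A i) (B i) (C i) x) := mul_le_mul_of_nonneg_left h hm2
      _ = m i * rowPsi1 e₁ e₂ (A i) (B i) (C i) x * (m i * rowPsi3 e₁ e₂ (A i) (B i) (C i) x) := by ring

end Cloud

/-! ### §3 The engine with an abstract pull, and the mixed-cloud cells -/

/-- ★ **HUMP versus ABSTRACT PULL.**  Row `a − bx^p − cx^q` non-vanishing on `[x₁, x₃] ⊂ (0,∞)` with rising (`ψ₁ < 0`), strictly log-concave (`ψ₁ψ₃ < ψ₂²`)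
slope; pull `P1 > 0` with `d/dx P1 = P2/x`, `d/dx P2 = P3/x`, `P2² ≤ P1·P3` on the window.  Then `ψ₁ + P1` has no three zeros. [this file's theorem] -/
theorem slope_no_three_zeros_of_pull (e₁ e₂ : ℕ) (a b c : ℝ) (P1 P2 P3 : ℝ → ℝ)
    {x₁ x₂ x₃ : ℝ} (h0 : 0 < x₁) (h12 : x₁ < x₂) (h23 : x₂ < x₃)
    (hF : ∀ x ∈ Set.Icc x₁ x₃, a - b * x ^ (e₁ + 1) - c * x ^ (e₁ + e₂ + 2) ≠ 0)
    (hpost : ∀ x ∈ Set.Icc x₁ x₃, rowPsi1 e₁ e₂ a b c x < 0)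
    (hlc : ∀ x ∈ Set.Icc x₁ x₃, rowPsi1 e₁ e₂ a b c x * rowPsi3 e₁ e₂ a b c x < rowPsi2 e₁ e₂ a b c x ^ 2)
    (hP1 : ∀ x ∈ Set.Icc x₁ x₃, 0 < P1 x) (hd1 : ∀ x ∈ Set.Icc x₁ x₃, HasDerivAt P1 (P2 x / x) x)
    (hd2 : ∀ x ∈ Set.Icc x₁ x₃, HasDerivAt P2 (P3 x / x) x) (hPlc : ∀ x ∈ Set.Icc x₁ x₃, P2 x ^ 2 ≤ P1 x * P3 x)
    (hzero : ∀ x ∈ ({x₁, x₂, x₃} : Set ℝ), rowPsi1 e₁ e₂ a b c x + P1 x = 0) : False := by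
  have hx0 : ∀ x ∈ Set.Icc x₁ x₃, 0 < x := fun x hx => h0.trans_le hx.1
  have hFzero : ∀ x ∈ ({x₁, x₂, x₃} : Set ℝ), Real.log (-rowPsi1 e₁ e₂ a b c x) - Real.log (P1 x) = 0 := by
    intro x hx
    have : -rowPsi1 e₁ e₂ a b c x = P1 x := by linarith [hzero x hx]
    rw [this, sub_self]
  have hFderiv : ∀ x ∈ Set.Icc x₁ x₃, HasDerivAt (fun t => Real.log (-rowPsi1 e₁ e₂ a b c t) - Real.log (P1 t))
      ((rowPsi2 e₁ e₂ a b c x / rowPsi1 e₁ e₂ a b c x - P2 x / P1 x) / x) x := by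
    intro x hx
    have hx' := hx0 x hx
    have h1' : HasDerivAt (fun t => -rowPsi1 e₁ e₂ a b c t) (-(rowPsi2 e₁ e₂ a b c x / x)) x :=
      (hasDerivAt_rowPsi1 e₁ e₂ a b c hx'.ne' (hF x hx)).neg
    have h1 := h1'.log (by have := hpost x hx; linarith)
    have h2 := (hd1 x hx).log (hP1 x hx).ne'
    refine (h1.sub h2).congr_deriv ?_
    have : rowPsi1 e₁ e₂ a b c x ≠ 0 := (hpost x hx).ne
    have : P1 x ≠ 0 := (hP1 x hx).ne'
    have : x ≠ 0 := hx'.ne'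
    field_simp
  have hFcont : ∀ y z, x₁ ≤ y → z ≤ x₃ →
      ContinuousOn (fun t => Real.log (-rowPsi1 e₁ e₂ a b c t) - Real.log (P1 t)) (Set.Icc y z) :=
    fun y z hy hz t ht => (hFderiv t ⟨hy.trans ht.1, ht.2.trans hz⟩).continuousAt.continuousWithinAt
  have hrolle : ∀ y z, x₁ ≤ y → y < z → z ≤ x₃ →
      Real.log (-rowPsi1 e₁ e₂ a b c y) - Real.log (P1 y) = 0 → Real.log (-rowPsi1 e₁ e₂ a b c z) - Real.log (P1 z) = 0 →
        ∃ η ∈ Set.Ioo y z, rowPsi2 e₁ e₂ a b c η / rowPsi1 e₁ e₂ a b c η - P2 η / P1 η = 0 := by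
    intro y z hy hyz hz hFy hFz
    obtain ⟨η, hη, hη'⟩ := exists_hasDerivAt_eq_zero hyz (hFcont y z hy hz) (hFy.trans hFz.symm)
      (fun t ht => hFderiv t ⟨hy.trans ht.1.le, ht.2.le.trans hz⟩)
    refine ⟨η, hη, ?_⟩
    rcases div_eq_zero_iff.1 hη' with h | h
    · exact h
    · exact absurd h (hx0 η ⟨hy.trans hη.1.le, hη.2.le.trans hz⟩).ne'
  obtain ⟨η₁, hη₁, hG1⟩ := hrolle x₁ x₂ le_rfl h12 h23.le (hFzero x₁ (by simp)) (hFzero x₂ (by simp))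
  obtain ⟨η₂, hη₂, hG2⟩ := hrolle x₂ x₃ h12.le h23 le_rfl (hFzero x₂ (by simp)) (hFzero x₃ (by simp))
  have hη12 : η₁ < η₂ := hη₁.2.trans hη₂.1
  have hGderiv : ∀ x ∈ Set.Icc x₁ x₃, ∃ D : ℝ, D < 0 ∧
      HasDerivAt (fun t => rowPsi2 e₁ e₂ a b c t / rowPsi1 e₁ e₂ a b c t - P2 t / P1 t) D x := by
    intro x hx
    have hx' := hx0 x hx
    have hψ1x := hpost x hx
    have hP1x := hP1 x hx
    have d1 := hasDerivAt_rowPsi1 e₁ e₂ a b c hx'.ne' (hF x hx)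
    have d2 := hasDerivAt_rowPsi2 e₁ e₂ a b c hx'.ne' (hF x hx)
    have hquot := (d2.div d1 hψ1x.ne).sub ((hd2 x hx).div (hd1 x hx) hP1x.ne')
    have hris := hlc x hx
    have hcl := hPlc x hx
    refine ⟨(rowPsi3 e₁ e₂ a b c x * rowPsi1 e₁ e₂ a b c x - rowPsi2 e₁ e₂ a b c x ^ 2) / (x * rowPsi1 e₁ e₂ a b c x ^ 2)
        - (P3 x * P1 x - P2 x ^ 2) / (x * P1 x ^ 2), ?_, ?_⟩
    · have t1 : (rowPsi3 e₁ e₂ a b c x * rowPsi1 e₁ e₂ a b c x - rowPsi2 e₁ e₂ a b c x ^ 2) / (x * rowPsi1 e₁ e₂ a b c x ^ 2) < 0 :=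
        div_neg_of_neg_of_pos (by linarith) (mul_pos hx' (sq_pos_iff.mpr hψ1x.ne))
      have t2 : 0 ≤ (P3 x * P1 x - P2 x ^ 2) / (x * P1 x ^ 2) := div_nonneg (by linarith) (by positivity)
      linarith
    · refine (hquot.congr_of_eventuallyEq (Filter.Eventually.of_forall fun t => ?_)).congr_deriv ?_
      · simp only [Pi.sub_apply, Pi.div_apply]
      · have : rowPsi1 e₁ e₂ a b c x ≠ 0 := hψ1x.ne
        have : P1 x ≠ 0 := hP1x.ne'
        have : x ≠ 0 := hx'.ne'
        field_simp
  have hGcont : ContinuousOn (fun t => rowPsi2 e₁ e₂ a b c t / rowPsi1 e₁ e₂ a b c t - P2 t / P1 t) (Set.Icc η₁ η₂) := fun t ht => by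
    obtain ⟨D, _, hD⟩ := hGderiv t ⟨hη₁.1.le.trans ht.1, ht.2.trans hη₂.2.le⟩
    exact hD.continuousAt.continuousWithinAt
  obtain ⟨ξ, hξ, hξ'⟩ := exists_deriv_eq_slope _ hη12 hGcont (fun t ht => by
    obtain ⟨D, _, hD⟩ := hGderiv t ⟨hη₁.1.le.trans ht.1.le, ht.2.le.trans hη₂.2.le⟩
    exact hD.differentiableAt.differentiableWithinAt)
  obtain ⟨D, hDneg, hD⟩ := hGderiv ξ ⟨hη₁.1.le.trans hξ.1.le, hξ.2.le.trans hη₂.2.le⟩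
  rw [hD.deriv, hG1, hG2, sub_zero, zero_div] at hξ'
  exact hDneg.ne hξ'

/-- ★★ **HUMP versus MIXED CLOUD.**  Row `a − bx^p − cx^q` non-vanishing with rising, strictly log-concave slope on `[x₁, x₃] ⊂ (0,∞)`; nonempty weighted cloud
whose rows are, at every point of the window, unswitched incoherent or switched coherent ⇒ `ψ₁ + cloudP1` has no three zeros. [this file's theorem] -/
theorem hump_mixedCloud_no_three_zeros (e₁ e₂ : ℕ) (a b c : ℝ)
    {ι : Type*} (s : Finset ι) (hs : s.Nonempty) (m A B C : ι → ℝ) (hm : ∀ i ∈ s, 0 < m i)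
    {x₁ x₂ x₃ : ℝ} (h0 : 0 < x₁) (h12 : x₁ < x₂) (h23 : x₂ < x₃)
    (hF : ∀ x ∈ Set.Icc x₁ x₃, a - b * x ^ (e₁ + 1) - c * x ^ (e₁ + e₂ + 2) ≠ 0)
    (hpost : ∀ x ∈ Set.Icc x₁ x₃, rowPsi1 e₁ e₂ a b c x < 0)
    (hlc : ∀ x ∈ Set.Icc x₁ x₃, rowPsi1 e₁ e₂ a b c x * rowPsi3 e₁ e₂ a b c x < rowPsi2 e₁ e₂ a b c x ^ 2)
    (hrow : ∀ x ∈ Set.Icc x₁ x₃, ∀ i ∈ s, (0 ≤ B i ∧ 0 ≤ C i ∧ 0 < B i + C i ∧ 0 < A i - B i * x ^ (e₁ + 1) - C i * x ^ (e₁ + e₂ + 2))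
      ∨ (0 < A i ∧ B i < 0 ∧ 0 < C i ∧ A i - B i * x ^ (e₁ + 1) - C i * x ^ (e₁ + e₂ + 2) < 0))
    (hzero : ∀ x ∈ ({x₁, x₂, x₃} : Set ℝ), rowPsi1 e₁ e₂ a b c x + cloudP1 e₁ e₂ s m A B C x = 0) : False := by
  have hx0 : ∀ x ∈ Set.Icc x₁ x₃, 0 < x := fun x hx => h0.trans_le hx.1
  have hne : ∀ x ∈ Set.Icc x₁ x₃, ∀ i ∈ s, A i - B i * x ^ (e₁ + 1) - C i * x ^ (e₁ + e₂ + 2) ≠ 0 := by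
    intro x hx i hi
    rcases hrow x hx i hi with ⟨_, _, _, h⟩ | ⟨_, _, _, h⟩
    · exact h.ne'
    · exact h.ne
  exact slope_no_three_zeros_of_pull e₁ e₂ a b c (cloudP1 e₁ e₂ s m A B C) (cloudP2 e₁ e₂ s m A B C) (cloudP3 e₁ e₂ s m A B C)
    h0 h12 h23 hF hpost hlc (fun x hx => (mixedCloud_lcP1 e₁ e₂ (hx0 x hx) hs hm (hrow x hx)).1)
    (fun x hx => mixedCloud_hasDerivAt1 e₁ e₂ s m A B C (hx0 x hx) (hne x hx))
    (fun x hx => mixedCloud_hasDerivAt2 e₁ e₂ s m A B C (hx0 x hx) (hne x hx))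
    (fun x hx => (mixedCloud_lcP1 e₁ e₂ (hx0 x hx) hs hm (hrow x hx)).2) hzero

/-- ★★ **The switched incoherent RISER against a mixed cloud** (`a ≥ 0`, `b, c > 0`, riser switched on the window): `ψ₁ + cloudP1` has no three zeros —
the ρ_I = 1 cell also on windows where coherent rows of the company have already switched. [this file's theorem] -/
theorem oneRiser_mixedCloud_no_three_zeros (e₁ e₂ : ℕ) {a b c : ℝ} (ha : 0 ≤ a) (hb : 0 < b) (hc : 0 < c)
    {ι : Type*} (s : Finset ι) (hs : s.Nonempty) (m A B C : ι → ℝ) (hm : ∀ i ∈ s, 0 < m i)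
    {x₁ x₂ x₃ : ℝ} (h0 : 0 < x₁) (h12 : x₁ < x₂) (h23 : x₂ < x₃)
    (hsw : ∀ x ∈ Set.Icc x₁ x₃, a - b * x ^ (e₁ + 1) - c * x ^ (e₁ + e₂ + 2) < 0)
    (hrow : ∀ x ∈ Set.Icc x₁ x₃, ∀ i ∈ s, (0 ≤ B i ∧ 0 ≤ C i ∧ 0 < B i + C i ∧ 0 < A i - B i * x ^ (e₁ + 1) - C i * x ^ (e₁ + e₂ + 2))
      ∨ (0 < A i ∧ B i < 0 ∧ 0 < C i ∧ A i - B i * x ^ (e₁ + 1) - C i * x ^ (e₁ + e₂ + 2) < 0))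
    (hzero : ∀ x ∈ ({x₁, x₂, x₃} : Set ℝ), rowPsi1 e₁ e₂ a b c x + cloudP1 e₁ e₂ s m A B C x = 0) : False := by
  have hx0 : ∀ x ∈ Set.Icc x₁ x₃, 0 < x := fun x hx => h0.trans_le hx.1
  have hI1 : x₁ ∈ Set.Icc x₁ x₃ := ⟨le_rfl, (h12.trans h23).le⟩
  have hP1 := (mixedCloud_lcP1 e₁ e₂ (hx0 x₁ hI1) hs hm (hrow x₁ hI1)).1
  have hstart : rowPsi1 e₁ e₂ a b c x₁ < 0 := by linarith [hzero x₁ (by simp)]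
  have hpost : ∀ x ∈ Set.Icc x₁ x₃, rowPsi1 e₁ e₂ a b c x < 0 := fun x hx =>
    (eq_or_lt_of_le hx.1).elim (fun h => h ▸ hstart)
      (fun h => riser_turning_persist e₁ e₂ a b c hb hc h0 (h12.trans h23).le hsw hstart.le x ⟨h, hx.2⟩)
  exact hump_mixedCloud_no_three_zeros e₁ e₂ a b c s hs m A B C hm h0 h12 h23 (fun x hx => (hsw x hx).ne) hpost
    (fun x hx => riser_slope_logConcave e₁ e₂ a b c (hx0 x hx) ha hb.le hc.le (hsw x hx) (hpost x hx)) hrow hzero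

/-- ★★ **The one-signed binomial KNEE against a mixed cloud** (`a·c < 0`, `b = 0` in normal form): `ψ₁ + cloudP1` has no three zeros on any window
`⊂ (0,∞)` on which the cloud rows are unswitched-incoherent or switched-coherent. [this file's theorem] -/
theorem oneKnee_mixedCloud_no_three_zeros (e₁ e₂ : ℕ) {a c : ℝ} (hac : a * c < 0)
    {ι : Type*} (s : Finset ι) (hs : s.Nonempty) (m A B C : ι → ℝ) (hm : ∀ i ∈ s, 0 < m i)
    {x₁ x₂ x₃ : ℝ} (h0 : 0 < x₁) (h12 : x₁ < x₂) (h23 : x₂ < x₃)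
    (hrow : ∀ x ∈ Set.Icc x₁ x₃, ∀ i ∈ s, (0 ≤ B i ∧ 0 ≤ C i ∧ 0 < B i + C i ∧ 0 < A i - B i * x ^ (e₁ + 1) - C i * x ^ (e₁ + e₂ + 2))
      ∨ (0 < A i ∧ B i < 0 ∧ 0 < C i ∧ A i - B i * x ^ (e₁ + 1) - C i * x ^ (e₁ + e₂ + 2) < 0))
    (hzero : ∀ x ∈ ({x₁, x₂, x₃} : Set ℝ), rowPsi1 e₁ e₂ a 0 c x + cloudP1 e₁ e₂ s m A B C x = 0) : False := by
  have hx0 : ∀ x ∈ Set.Icc x₁ x₃, 0 < x := fun x hx => h0.trans_le hx.1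
  have hF : ∀ x ∈ Set.Icc x₁ x₃, a - 0 * x ^ (e₁ + 1) - c * x ^ (e₁ + e₂ + 2) ≠ 0 := by
    intro x hx h
    have ha : a = c * x ^ (e₁ + e₂ + 2) := by linarith
    rw [ha] at hac
    have : 0 ≤ c * x ^ (e₁ + e₂ + 2) * c := by
      have := sq_nonneg c; nlinarith [pow_pos (hx0 x hx) (e₁ + e₂ + 2)]
    linarith
  have hpost : ∀ x ∈ Set.Icc x₁ x₃, rowPsi1 e₁ e₂ a 0 c x < 0 := fun x hx => knee_rowPsi1_neg e₁ e₂ a c (hx0 x hx) hac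
  exact hump_mixedCloud_no_three_zeros e₁ e₂ a 0 c s hs m A B C hm h0 h12 h23 hF hpost
    (fun x hx => binomial_slope_logConcave e₁ e₂ a 0 c x (by ring) (hpost x hx)) hrow hzero

/-- ★★ **The rising unswitched COHERENT row against a mixed cloud** (`a > 0`, `b ≤ 0 ≤ c`, value `> 0` and `ψ₁ < 0` on the window). [this file's theorem] -/
theorem oneCoherent_mixedCloud_no_three_zeros (e₁ e₂ : ℕ) {a b c : ℝ} (ha : 0 < a) (hb : b ≤ 0) (hc : 0 ≤ c)
    {ι : Type*} (s : Finset ι) (hs : s.Nonempty) (m A B C : ι → ℝ) (hm : ∀ i ∈ s, 0 < m i)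
    {x₁ x₂ x₃ : ℝ} (h0 : 0 < x₁) (h12 : x₁ < x₂) (h23 : x₂ < x₃)
    (hun0 : ∀ x ∈ Set.Icc x₁ x₃, 0 < a - b * x ^ (e₁ + 1) - c * x ^ (e₁ + e₂ + 2))
    (hpost : ∀ x ∈ Set.Icc x₁ x₃, rowPsi1 e₁ e₂ a b c x < 0)
    (hrow : ∀ x ∈ Set.Icc x₁ x₃, ∀ i ∈ s, (0 ≤ B i ∧ 0 ≤ C i ∧ 0 < B i + C i ∧ 0 < A i - B i * x ^ (e₁ + 1) - C i * x ^ (e₁ + e₂ + 2))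
      ∨ (0 < A i ∧ B i < 0 ∧ 0 < C i ∧ A i - B i * x ^ (e₁ + 1) - C i * x ^ (e₁ + e₂ + 2) < 0))
    (hzero : ∀ x ∈ ({x₁, x₂, x₃} : Set ℝ), rowPsi1 e₁ e₂ a b c x + cloudP1 e₁ e₂ s m A B C x = 0) : False :=
  hump_mixedCloud_no_three_zeros e₁ e₂ a b c s hs m A B C hm h0 h12 h23 (fun x hx => (hun0 x hx).ne') hpost
    (fun x hx => coherent_slope_logConcave e₁ e₂ a b c (h0.trans_le hx.1) ha hb hc (hun0 x hx) (hpost x hx)) hrow hzero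

end ProductPlusOne

end Summit.ValiantsHypothesis.ValiantsHypothesis.Theorems.LacunarySymmetroidMatrixDescartes
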